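import Literature.NumberTheory.Automorphic.UnitaryGroupTorusSiegelSet
import Literature.NumberTheory.Automorphic.UnitaryGroupTorusThreeRay
import HarnessLib

/-!
# The torus Siegel data of `U(J₃)` in the letters of the torus window integral
# (Siegel set `S ⊆ ray · compact`, covering by `T(F)`, the diagonal ray and its height law)
(Arthur, *A trace formula for reductive groups I*, Duke Math. J. 45 (1978), §1; Rogawski, *Automorphic
Representations of Unitary Groups in Three Variables* (1990), §2.2 p. 13; Borel, *Introduction aux groupes
arithmétiques* (1969), §§12–15 (Siegel sets of tori: `T(F)\T(𝔸)¹` compact).)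

Topic `NumberTheory/Automorphic`; namespace `Literature.NumberTheory.Automorphic.UnitaryGroup`. THEOREMS ONLY over
accepted tree modules: no definition, no named fact, no instance, no notation, no `sorry`. Row (L2-s) «TORUS SIEGEL
DATA» of the T1-qs LAW 2 road (`UnitaryGroup.TruncatedTracePolynomial`) of the engine line
`Cruxes/H413/Lines/F0_T1InnerFormTraceIdentity.lean`: the ADAPTER between row H9a (★ `exists_torusSiegelSet`:
a closed torus Siegel set `S_T ⊆ B(𝔸_F)` with `torusPart t = t`, coordinates `d₀ = w · r(e^s)`, `d₁ ∈ W`, `W`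
compact, and a cover by the rational torus) + row H10b's ray (★ `exists_torusRay`, ★ `isCompact_setOf_diagUnit_mem`)
and the HYPOTHESIS BUNDLE of the torus window integral (L2-dT) (★ `UnitaryGroupTorusWindowIntegral`,
`exists_lintegral_weight_mul_indicator_window_eq`): a measurable `S ⊆ T(𝔸_F)` inside `range ρ · 𝔎` (`𝔎` compact,
`ρ` a continuous ray with `H(ρ(s) t) = e^{κ s} H(t)`, `κ = [E:ℚ] > 0`) meeting every `T(F)`-orbit.

* `diagUnit_torus_one`, `diagUnit_torus_inv` — `d_i(1) = 1`, `d_i(t⁻¹) = d_i(t)⁻¹` on `T(𝔸_F)` (★ `diagUnit_torus_mul`).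
* **`exists_torusSiegelData (h2 : [E:F] = 2) (hc : c² = 1) (hc1 : c ≠ 1)`** — `∃ S 𝔎 ρ`, `MeasurableSet S ∧ IsCompact 𝔎 ∧
  Continuous ρ ∧ 0 < [E:ℚ] ∧ (∀ s t, H(ρ s · t) = exp([E:ℚ] s) H t) ∧ S ⊆ range ρ * 𝔎 ∧ ∀ t, ∃ τ ∈ T(F)_T, τ • t ∈ S`
  with `T(F)_T := (rationalBorel F E c 3).subgroupOf (torusInBorel F E c 3)` — token for token the binders
  `(hSm) (h𝔎) (hρc) (hκ) (hH) (hS) (hcov)` of (L2-dT).  Proof: `S := T(𝔸_F) ∩ S_T`, `𝔎 := {k | d₀ k ∈ W ∧ d₁ k ∈ W}`,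
  `t = ρ(s) · (ρ(s)⁻¹ t)` with `d₀(ρ(s)⁻¹ t) = w`, `d₁(ρ(s)⁻¹ t) = d₁(t)`.

## References
* J. Arthur, *A trace formula for reductive groups I*, Duke Math. J. 45 (1978), §1 [Arthur1978TraceFormulaI].
* J. D. Rogawski, *Automorphic Representations of Unitary Groups in Three Variables*, Ann. of Math. Stud. 123 (1990),
  §2.2 (p. 13) [Rogawski1990].
* A. Borel, *Introduction aux groupes arithmétiques* (1969), §§12–15 [Borel1969].
-/

set_option autoImplicit false

noncomputable section

open MeasureTheory NumberField IsDedekindDomain Set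
open scoped NNReal ENNReal Pointwise

namespace Literature.NumberTheory.Automorphic

namespace UnitaryGroup

variable {F E : Type} [Field F] [NumberField F] [Field E] [NumberField E] [Algebra F E]
  {c : E ≃ₐ[F] E}

/-! ## §1 Diagonal entries of `1` and of inverses on the torus -/

/-- `d_i(1) = 1` on `T(𝔸_F)`. [cite: Rogawski1990, §1.10] -/
theorem diagUnit_torus_one (i : Fin 3) :
    diagUnit ((1 : torusInBorel F E c 3) : borelAdelic F E c 3).2 i = 1 := by
  have h := diagUnit_torus_mul (1 : torusInBorel F E c 3) (1 : torusInBorel F E c 3) i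
  rw [mul_one] at h
  exact mul_left_cancel (a := diagUnit ((1 : torusInBorel F E c 3) : borelAdelic F E c 3).2 i)
    (by rw [← h, mul_one])

/-- `d_i(t⁻¹) = d_i(t)⁻¹` on `T(𝔸_F)` (★ `diagUnit_torus_mul`). [cite: Rogawski1990, §1.10] -/
theorem diagUnit_torus_inv (t : torusInBorel F E c 3) (i : Fin 3) :
    diagUnit ((t⁻¹ : torusInBorel F E c 3) : borelAdelic F E c 3).2 i =
      (diagUnit (t : borelAdelic F E c 3).2 i)⁻¹ := by
  refine eq_inv_of_mul_eq_one_left ?_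
  rw [← diagUnit_torus_mul, inv_mul_cancel, diagUnit_torus_one]

/-! ## §2 The torus Siegel data -/

section Data

variable [MeasurableSpace (quasiSplit F E c 3).Adelic] [BorelSpace (quasiSplit F E c 3).Adelic]

/-- **THE TORUS SIEGEL DATA OF `U(J₃)` (row (L2-s)).**  For `[E : F] = 2`, `c² = 1`, `c ≠ 1` there are a
measurable set `S ⊆ T(𝔸_F)`, a compact `𝔎 ⊆ T(𝔸_F)` and a continuous ray `ρ : ℝ → T(𝔸_F)` with the height law
`H(ρ(s) t) = e^{[E:ℚ] s} H(t)`, such that `S ⊆ range ρ · 𝔎` and every orbit of the rational torus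
`T(F)_T := (rationalBorel F E c 3).subgroupOf (torusInBorel F E c 3)` meets `S` — the hypothesis bundle
`(hSm, h𝔎, hρc, hκ, hH, hS, hcov)` of ★ `exists_lintegral_weight_mul_indicator_window_eq` (L2-dT), assembled from
row H9a's torus Siegel set (★ `exists_torusSiegelSet`: `S := T(𝔸_F) ∩ S_T`) and row H10b's diagonal ray
(★ `exists_torusRay`; `𝔎 := {k | d₀(k) ∈ W ∧ d₁(k) ∈ W}` is compact by ★ `isCompact_setOf_diagUnit_mem`, and
`t = ρ(s) · (ρ(s)⁻¹ t)` with `d₀(ρ(s)⁻¹ t) = w ∈ W`, `d₁(ρ(s)⁻¹ t) = d₁(t) ∈ W`).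
[cite: Borel1969, §§12–15] [cite: Arthur1978TraceFormulaI, §1] [cite: Rogawski1990, §2.2 (p. 13)] -/
theorem exists_torusSiegelData (h2 : Module.finrank F E = 2) (hc : c * c = 1) (hc1 : c ≠ 1) :
    ∃ (S 𝔎 : Set (torusInBorel F E c 3)) (ρ : ℝ → torusInBorel F E c 3),
      MeasurableSet S ∧ IsCompact 𝔎 ∧ Continuous ρ ∧ 0 < (Module.finrank ℚ E : ℝ) ∧
      (∀ (s : ℝ) (t : torusInBorel F E c 3),
        (borelHeight (((ρ s * t : torusInBorel F E c 3) : borelAdelic F E c 3) : (quasiSplit F E c 3).Adelic) : ℝ) =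
          Real.exp ((Module.finrank ℚ E : ℝ) * s) *
            borelHeight (((t : torusInBorel F E c 3) : borelAdelic F E c 3) : (quasiSplit F E c 3).Adelic)) ∧
      S ⊆ Set.range ρ * 𝔎 ∧
      ∀ t : torusInBorel F E c 3,
        ∃ τ : (rationalBorel F E c 3).subgroupOf (torusInBorel F E c 3), τ • t ∈ S := by
  obtain ⟨S_T, W, hclosed, hW, hSTt, hexp, hcov, -, -⟩ := exists_torusSiegelSet (F := F) (E := E) (c := c) h2 hc1
  obtain ⟨ρ, hρc, -, hρd, hρH⟩ := exists_torusRay (F := F) (E := E) (c := c) hc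
  refine ⟨((↑) : torusInBorel F E c 3 → borelAdelic F E c 3) ⁻¹' S_T,
    {k : torusInBorel F E c 3 | diagUnit (k : borelAdelic F E c 3).2 0 ∈ W ∧ diagUnit (k : borelAdelic F E c 3).2 1 ∈ W},
    ρ, (hclosed.preimage continuous_subtype_val).measurableSet, isCompact_setOf_diagUnit_mem hc hW hW, hρc,
    Nat.cast_pos.2 Module.finrank_pos, hρH, ?_, ?_⟩
  · -- `S ⊆ range ρ · 𝔎`
    intro t ht
    obtain ⟨w, hw, s, h0, h1, -, -⟩ := hexp (t : borelAdelic F E c 3) ht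
    refine Set.mem_mul.2 ⟨ρ s, Set.mem_range_self s, (ρ s)⁻¹ * t, ⟨?_, ?_⟩, mul_inv_cancel_left _ _⟩
    · rw [diagUnit_torus_mul, diagUnit_torus_inv, (hρd s).1, h0, mul_comm w, inv_mul_cancel_left]
      exact hw
    · rw [diagUnit_torus_mul, diagUnit_torus_inv, (hρd s).2, inv_one, one_mul]
      exact h1
  · -- every `T(F)`-orbit meets `S`
    intro t
    obtain ⟨τ, hτrat, hτt, hτS⟩ := hcov (t : borelAdelic F E c 3) ((mem_torusInBorel_iff_torusPart_eq _).1 t.2)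
    refine ⟨⟨⟨τ, (mem_torusInBorel_iff_torusPart_eq τ).2 hτt⟩, Subgroup.mem_subgroupOf.2 (Subgroup.mem_comap.2 hτrat)⟩,
      ?_⟩
    rw [Subgroup.smul_def, smul_eq_mul]
    exact hτS

end Data

end UnitaryGroup

end Literature.NumberTheory.Automorphic
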